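import Literature.NumberTheory.Automorphic.ShimuraCurveRibetTakahashi
import Literature.NumberTheory.EllipticCurves.Tamagawa
import Literature.NumberTheory.EllipticCurves.GaloisAction
import Literature.NumberTheory.EllipticCurves.GlobalMinimalModel
import HarnessLib

/-!
# Pasten 2024 §6: the Ribet–Takahashi component package of an isogeny class, read at a prime `p`
# with `E[p]` irreducible

Topic `NumberTheory/Automorphic`; a statement-level companion (ONE named fact `def … : Prop`, D-0014;
no theorem, no `sorry`) of `ShimuraCurveRibetTakahashi.lean`, whose vocabulary it uses:
`ShimuraCurveData D M` (the Shimura curve `X₀^D(M)`), `ShimuraParametrizationData X W'` (a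
parametrisation datum with its degree `deg`), `ShimuraParametrizationData.IsMinimalFor` (Pasten's
class-minimal degree `δ_{D,M}`), and the classical `ModularParametrizationData` / `IsNewformOf`
(`δ_{1,N}` as in `exists_optimal_modularParametrizationData`).

## Source (read in the held arXiv text `paper:arxiv-1705.09251` = J. Number Theory 254 (2024) 214–335)

H. Pasten, J. Number Theory 254 (2024) 214–335 [PastenShimura2024] (title in `references.bib`):
* §2 p. 12: for an admissible factorisation `N = DM` (`D` the product of an even number of distinct
  primes, coprime to `M`) "the Jacquet–Langlands correspondence gives an optimal quotient
  `q_{D,M} : J₀^D(M) → A_{D,M}` … with `A_{D,M}` isogenous to `E`", `q_{D,M} q_{D,M}^∨ = [δ_{D,M}]`;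
  `δ_{1,N}` is the modular degree of the optimal quotient of `J₀(N)`.
* §6.4 p. 22: for a prime `q ∥ N`, "`Φ_q(A)` is a cyclic group of order `c_q(A) := v_q(Δ_A)`" (the group
  of geometric connected components of the Néron model at `q` of any `A` of the class).
* Lemma 6.8 p. 22 and its proof: "Let `α : A → B` be an isogeny of minimal degree … `n := deg(α)` …";
  the maps `Φ_q(A) → Φ_q(B) → Φ_q(A)` induced by `α` and `α^∨` compose to multiplication by `n` on the
  cyclic group `Φ_q(A)`, so numerator and denominator of `c_q(A)/c_q(B)` divide `n` (printed conclusion: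
  "`c_q(A)/c_q(B)` is a rational number whose multiplicative height is at most `163`" via Mazur–Kenku).
* §6.6 p. 23: `i_q(D,M)` and `j_q(D,M)` are the orders of the image and of the cokernel of the map
  `q_{D,M,q,*} : Φ_q(J₀^D(M)) → Φ_q(A_{D,M})` induced on component groups; hence
  `i_q(D,M) · j_q(D,M) = #Φ_q(A_{D,M}) = c_q(A_{D,M})`.
* **Prop. 6.13** p. 23: for `N = d p r M` with `d` admissible and `p ≠ r` primes `∥ N` outside `d`,
  `δ_{d,prM}/δ_{dpr,M} = c_p(A_{d,prM}) · c_r(A_{dpr,M}) / (i_p(d,prM)² · j_r(dpr,M)²)`. "Except for the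
  notation, this is Theorem 2 in [RiTa]" (K. Ribet, S. Takahashi, PNAS 94 (1997), Thm. 2
  [RibetTakahashi1997]); "the proof in loc. cit. does not need `M` to be squarefree … one just needs
  multiplicative reduction at the two primes".
* Lemma 6.14 p. 23, proof: "the group `Φ_p(J₀^D(M))` is Eisenstein … (cf. [RibetEisenstein]). On the
  other hand, since `A_{D,M}` is the optimal quotient associated to `χ_{D,M}`, the action of `T_r` on
  `J₀^D(M)` induces multiplication by `a_r(A_{D,M})` on `A_{D,M}` … It follows that
  `i_p(J₀^D(M), χ_{D,M})` divides `r + 1 − a_r(A_{D,M})` for every prime `r ∤ N`" (here `p ∥ M`).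

## Rendering (the receptacle shapes (P613), (Pij), (P68), (PEis))

The BSD consumer (`Summits/BirchSwinnertonDyer/Rank1Residual/X11b/BDPRouteRTDegreeTelescope.lean`,
`RTDegree.padicValNat_delta_empty_eq_of_witness`: Pasten's §6.9 telescoping and the switching Lemmas
6.15/6.16 performed at ONE non-Eisenstein prime) is stated over functions on finite sets of primes, and
so is this fact: `E` is a globally minimal `W` of conductor `N`; `Mult(E)` = the primes `q ∣ N` of
multiplicative reduction (`HasMultiplicativeReductionAtPrime`, i.e. `q ∥ N`); `c_q(E) =
padicValInt q W.minimalDiscriminantInt`; `δ(D) := δ_{∏D, N/∏D}`, `cA D q := c_q(A_{∏D, N/∏D})`,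
`ι D q := i_q(∏D, N/∏D)`, `κ D q := j_q(∏D, N/∏D)` for `D ⊆ Mult(E)` of even size — extended trivially
(`δ := δ_{1,N}`, `cA D q := κ D q := c_q(E)`, `ι := 1`) to subsets of odd size, where there is no
Shimura curve and the four displayed conjuncts become tautologies; the pin `δ ∅ = δ_{1,N}` is
`D₀.modularDegree` for a classical datum `D₀` of the class with the newform of `W` and minimal degree;
and the ANCHOR ties `δ`, `cA` to the tree's Shimura-curve objects: for every admissible `D`, every
`X : ShimuraCurveData (∏D) (N/∏D)` and every class-minimal datum `P` on it (`P.IsMinimalFor W` — the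
rendering of `q_{D,M}`, module docstring of `ShimuraCurveRibetTakahashi.lean`), `P.deg = δ D` and
`c_q` of the curve `P` parametrises is `cA D q` (both are independent of the choices: Eichler orders
of a given level in an indefinite rational quaternion algebra are conjugate, and the optimal quotient
is unique up to isomorphism). (P68) carries `p ∤ n`: when `E[p]` is irreducible any two curves of the
class are joined by an isogeny of degree prime to `p` (an isogeny whose kernel `G` has order divisible
by `p` has `0 ≠ G[p] ⊆ E[p]` Galois-stable, so `G ⊇ E[p]` and the isogeny factors through `[p]`;
induct) — this is why the fact takes the prime `p` and the irreducibility hypothesis. The component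
orders `i_q`, `j_q` have no tree vocabulary (no Néron models of `J₀^D(M)` in Mathlib or the tree; cf.
the functions `cI`, `cJ` of `ShimuraCurveRibetTakahashiCokernelProofs.lean` §III) — hence the
existential package, exactly as the typed input (T2♯-RT) of the BSD cell `b2b-bsdres`
(`X11b/BDPRouteUpperDegree.lean`).

## Faithfulness notes

* Each displayed conjunct is a printed statement (Prop. 6.13; §6.6; the proof of Lemma 6.8; the
  proof of Lemma 6.14) about the objects `δ_{D,M}`, `c_q(A_{D,M})`, `i_q`, `j_q`; the fact asserts the
  existence of integers with these properties and anchors the two that the tree can name. It is the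
  `p`-adically EXACT twin of the tree's bounded renderings `PastenShimura2024_thm_6_1`,
  `PastenShimura2024_thm_6_1_b`, `PastenShimura2024_pairwise_denominator` (which keep only sizes) —
  not a restatement of any of them, and not of the BSD cruxes it serves (those quantify over Heegner
  fields and Selmer data).
* `a_r(A_{D,M}) = a_r(E)` (`W.LFunction r`) by isogeny invariance of the `L`-function (tree theorem
  `LFunction_eq_of_isIsogenous_holds`), so (PEis) is displayed with `a_r(E)`.
* No junk: all displayed naturals are asserted positive; on odd-size `D` the conjuncts are satisfiable
  by the trivial extension; `padicValInt q` of the minimal discriminant of a multiplicative `q` is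
  `≥ 1`; `D₀` exists by Modularity (`exists_optimal_modularParametrizationData_of_modularity`).
* Size XL (Čerednik–Drinfeld and Deligne–Rapoport, Grothendieck's monodromy pairing, Ribet's exact
  sequence and Eisenstein property; Jacquet–Langlands). No `_holds`.

## Not here

Pasten's bounded consequences (Thm. 6.1, 6.17: `ShimuraCurveRibetTakahashi.lean` and its proof
companions); the telescoping (BSD kernel, loc. cit.); CM points on `X₀^D(M)` (see
`Literature/NumberTheory/EllipticCurves/ShimuraCurveHeegnerPointKolyvagin.lean`).
-/

noncomputable section

open scoped Classical

namespace Literature.NumberTheory.Automorphic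

open Literature.NumberTheory.EllipticCurves.ModularForms (ModularParametrizationData IsNewformOf)

/-- **Pasten 2024 §6 — the Ribet–Takahashi component package of the isogeny class of `E/ℚ`, at a
prime `p` with `E[p]` irreducible** (H. Pasten, J. Number Theory 254 (2024) 214–335 =
arXiv:1705.09251: **Prop. 6.13** p. 23 "= Theorem 2 in [RiTa]"
(Ribet–Takahashi, PNAS 94 (1997), Thm. 2): `δ_{d,qrM} · i_q(d,qrM)² · j_r(dqr,M)² =
δ_{dqr,M} · c_q(A_{d,qrM}) · c_r(A_{dqr,M})` for `d` admissible and `q ≠ r` two further primes `∥ N`;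
**§6.6** p. 23 with §6.4 p. 22: `i_q(D,M) · j_q(D,M) = #Φ_q(A_{D,M}) = c_q(A_{D,M}) = v_q(Δ_{A_{D,M}})`;
**proof of Lemma 6.8** p. 22: numerator and denominator of `c_q(A)/c_q(E)` divide the degree `n` of an
isogeny `E → A` — taken of degree prime to `p`, which exists as `E[p]` is irreducible; **proof of
Lemma 6.14** p. 23 (Ribet's Eisenstein property of `Φ_q(J₀^D(M))`, `q ∥ M`): `i_q(D,M) ∣ r + 1 − a_r(E)`
for every prime `r ∤ N`). RENDERING (module docstring): `E` a globally minimal `W` of conductor `N`,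
`Mult(E)` the filter of `N.primeFactors` by `HasMultiplicativeReductionAtPrime`, functions `δ`
(`δ D = δ_{∏D,N/∏D}`), `cA` (`c_q(A_{∏D,N/∏D})`), `ι` (`i_q`), `κ` (`j_q`) on subsets of `Mult(E)`
(trivially extended off the even ones), `c_q(E) = padicValInt q W.minimalDiscriminantInt`, the pin
`δ ∅ = δ_{1,N} = D₀.modularDegree` (`D₀` a classical datum of the class with the newform of `W`, of
minimal degree), and the ANCHOR `P.deg = δ D`, `c_q(curve of P) = cA D q` for every class-minimal
Shimura datum `P` (`IsMinimalFor`) on every `X : ShimuraCurveData (∏D) (N/∏D)`. The shapes (P613),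
(Pij), (P68), (PEis) are verbatim those telescoped by the BSD kernel
`Summits/…/X11b/BDPRouteRTDegreeTelescope.lean`. Size XL; no `_holds`.
[cite: PastenShimura2024, Prop. 6.13 p. 23; §6.6 p. 23; Lemma 6.8 (proof) p. 22; Lemma 6.14 (proof) p. 23; §2 p. 12]
[cite: RibetTakahashi1997, Thm. 2] -/
def PastenShimura2024_ribetTakahashiPackage : Prop :=
  ∀ (W : WeierstrassCurve ℚ) [W.IsElliptic] [W.IsGloballyMinimal] (p : ℕ) [Fact p.Prime],
    W.HasIrreducibleModPGaloisRep p →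
  ∀ (N : ℕ) [NeZero N] (W₀ : WeierstrassCurve ℚ) [W₀.IsElliptic] [W₀.IsGloballyMinimal]
    (D₀ : ModularParametrizationData W₀ N),
    W.conductorNorm ℤ = N → IsNewformOf W D₀.f → W.IsIsogenous W₀ →
    (∀ (W₂ : WeierstrassCurve ℚ) [W₂.IsElliptic] (D₂ : ModularParametrizationData W₂ N),
      D₂.f = D₀.f → D₀.modularDegree ≤ D₂.modularDegree) →
  ∃ (δ : Finset ℕ → ℕ) (cA ι κ : Finset ℕ → ℕ → ℕ),
    -- the pin `δ(∅) = δ_{1,N}`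
    δ ∅ = D₀.modularDegree ∧
    (∀ D, 0 < δ D) ∧ (∀ D q, 0 < cA D q) ∧
    -- ANCHOR: `δ(D) = δ_{∏D, N/∏D}` and `cA D q = c_q(A_{∏D, N/∏D})` on the class-minimal data
    (∀ ⦃D : Finset ℕ⦄, D ⊆ (W.conductorNorm ℤ).primeFactors.filter
          (fun q ↦ ∃ h : q.Prime, @WeierstrassCurve.HasMultiplicativeReductionAtPrime W q ⟨h⟩) →
        Even D.card →
      ∀ (X : ShimuraCurveData (∏ q ∈ D, q) (N / ∏ q ∈ D, q)) (W' : WeierstrassCurve ℚ)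
        [W'.IsElliptic] (P : ShimuraParametrizationData X W'), P.IsMinimalFor W →
        P.deg = δ D ∧
          ∀ q ∈ (W.conductorNorm ℤ).primeFactors.filter
            (fun q ↦ ∃ h : q.Prime, @WeierstrassCurve.HasMultiplicativeReductionAtPrime W q ⟨h⟩),
            cA D q = (W'.minimalDiscriminantNorm ℤ).factorization q) ∧
    -- (P613) Pasten 2024 Prop. 6.13 = Ribet–Takahashi 1997 Thm. 2
    (∀ ⦃d : Finset ℕ⦄, d ⊆ (W.conductorNorm ℤ).primeFactors.filter
          (fun q ↦ ∃ h : q.Prime, @WeierstrassCurve.HasMultiplicativeReductionAtPrime W q ⟨h⟩) →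
        Even d.card →
      ∀ ⦃q r : ℕ⦄,
        q ∈ (W.conductorNorm ℤ).primeFactors.filter
          (fun q ↦ ∃ h : q.Prime, @WeierstrassCurve.HasMultiplicativeReductionAtPrime W q ⟨h⟩) →
        r ∈ (W.conductorNorm ℤ).primeFactors.filter
          (fun q ↦ ∃ h : q.Prime, @WeierstrassCurve.HasMultiplicativeReductionAtPrime W q ⟨h⟩) →
        q ∉ d → r ∉ d → q ≠ r →
        δ d * ι d q ^ 2 * κ (insert q (insert r d)) r ^ 2 =
          δ (insert q (insert r d)) * cA d q * cA (insert q (insert r d)) r) ∧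
    -- (Pij) `i_q(D,M) · j_q(D,M) = #Φ_q(A_{D,M}) = c_q(A_{D,M})` (§6.4, §6.6)
    (∀ ⦃D : Finset ℕ⦄, D ⊆ (W.conductorNorm ℤ).primeFactors.filter
          (fun q ↦ ∃ h : q.Prime, @WeierstrassCurve.HasMultiplicativeReductionAtPrime W q ⟨h⟩) →
      ∀ ⦃q : ℕ⦄, q ∈ (W.conductorNorm ℤ).primeFactors.filter
          (fun q ↦ ∃ h : q.Prime, @WeierstrassCurve.HasMultiplicativeReductionAtPrime W q ⟨h⟩) →
        ι D q * κ D q = cA D q) ∧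
    -- (P68) proof of Lemma 6.8, with an isogeny of degree `n` prime to `p` (`E[p]` irreducible)
    (∀ ⦃D : Finset ℕ⦄, D ⊆ (W.conductorNorm ℤ).primeFactors.filter
          (fun q ↦ ∃ h : q.Prime, @WeierstrassCurve.HasMultiplicativeReductionAtPrime W q ⟨h⟩) →
      ∃ n : ℕ, 0 < n ∧ ¬ p ∣ n ∧
        ∀ q ∈ (W.conductorNorm ℤ).primeFactors.filter
            (fun q ↦ ∃ h : q.Prime, @WeierstrassCurve.HasMultiplicativeReductionAtPrime W q ⟨h⟩),
          cA D q ∣ n * padicValInt q W.minimalDiscriminantInt ∧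
            padicValInt q W.minimalDiscriminantInt ∣ n * cA D q) ∧
    -- (PEis) proof of Lemma 6.14: `i_q(d, N/∏d) ∣ r + 1 − a_r(E)` for `q ∥ N/∏d` and every prime `r ∤ N`
    (∀ ⦃d : Finset ℕ⦄, d ⊆ (W.conductorNorm ℤ).primeFactors.filter
          (fun q ↦ ∃ h : q.Prime, @WeierstrassCurve.HasMultiplicativeReductionAtPrime W q ⟨h⟩) →
      ∀ ⦃q : ℕ⦄, q ∈ (W.conductorNorm ℤ).primeFactors.filter
          (fun q ↦ ∃ h : q.Prime, @WeierstrassCurve.HasMultiplicativeReductionAtPrime W q ⟨h⟩) →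
        q ∉ d → ∀ r : ℕ, r.Prime → ¬ r ∣ W.conductorNorm ℤ →
          (ι d q : ℤ) ∣ (r : ℤ) + 1 - W.LFunction r)

end Literature.NumberTheory.Automorphic

end
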